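import Literature.NumberTheory.EllipticCurves.KummerSequenceConnecting
import Literature.NumberTheory.EllipticCurves.KummerImageIsotropy
import Literature.NumberTheory.GaloisRepresentations.ContinuousCupProductCompat
import HarnessLib

/-!
# Descent of a Weil pairing along the level: `E[d] × E[d] → μ_{kd}` and `E[d] × E[kd] → μ_{kd}` from `e_{kd}`

Topic `NumberTheory/EllipticCurves`; namespace `Literature.NumberTheory.EllipticCurves` (as
`KummerImageIsotropy.lean`, whose packaging `weilPairingHom` / `weilContPairing` is reused).
Definitions with bodies and theorems only: **no named fact is introduced** (D-0026).

The construction of the Cassels–Tate pairing at level `m` uses the auxiliary level `m²` (lifts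
`b₁ ∈ H¹(K, E[m²])`, local lifts in `H¹(K_v, E[m²])`; Milne, *ADT*, I, proof of Prop. 6.9) and the
compatibility of the Weil pairings `e_{m²}(ι S, T̃) = e_m(S, m T̃)` (Silverman *AEC* III.8.1(e)). The
tree knows Weil pairings only level by level (`WeierstrassCurve.exists_weilPairing`, one `e` per
level, with no compatibility). This file therefore DERIVES the lower-level pairing from a pairing
`e` at the top level `kd`, keeping all values in `μ_{kd}`:

* levels: `inclKD : E[d] ↪ E[kd]`, `mulK : E[kd] → E[d]` (`P ↦ kP`; the tree's `torsionMulBy k d`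
  re-typed at the level `((k * d : ℕ) : ℤ)`, `mulK_apply_eq`), `mulK_surjective`, `kRoot` (a `k`-th
  root in `E[kd]`), `inclKD_eq_nsmul_kRoot` (`ι T = k • T̃`);
* `descendHom W k d e … : E[d] →+ E[d] →+ μ_{kd}`, `(S, T) ↦ e(ι S, T̃)` — well defined
  (`weilPairingHom_inclKD_kRoot_eq`: `e(ι S, ·)` kills `ker [k]`), with `descendHom_apply_eq` (any
  root), `descendHom_mulK_left` (`descendHom ([k]S') T = e(S', ι T)`), alternating
  (`descendHom_self`), non-degenerate (`eq_zero_of_forall_descendHom_eq_zero`), `Γ_F`-equivariant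
  (`descendHom_smul`); as `ContPairing`s `descendPairing : E[d] × E[d] → μ_{kd}` and
  `mixPairing : E[d] × E[kd] → μ_{kd}` (`(S, T̃) ↦ e(ι S, T̃)`);
* cup products: **`ι_* x ∪_{kd} ỹ = x ∪_mix ỹ = x ∪_desc ([k]_* ỹ)`** (`cupProduct_weil_map_inclKD`,
  `cupProduct_mix_eq_descend`, `cupProduct_weil_map_inclKD_eq_descend`, by the tree's
  `ContPairing.cupProduct_adjoint`), hence `ι_* x ∪_{kd} ỹ = 0` if `[k]_* ỹ = 0`
  (`cupProduct_weil_map_inclKD_eq_zero`) — the identity `⟨ι c, b'_{v,1}⟩_{m²} = ⟨c, b'_v⟩` making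
  Milne's value independent of the local lift `b'_{v,1}`.

Motivation: provefact `WeierstrassCurve.exists_casselsTate_pairing` (Silverman *AEC* X.4.14).

## References

* [SilvermanAEC2009] J. H. Silverman, *The Arithmetic of Elliptic Curves*, 2nd ed. (2009),
  Prop. III.8.1 (e) (compatibility of the Weil pairings).
* [MilneADT2006] J. S. Milne, *Arithmetic Duality Theorems*, 2nd ed. (2006), Ch. I §6, proof of
  Prop. 6.9 (pp. 78–79).
-/

noncomputable section

open scoped Classical

universe u

namespace Literature.NumberTheory.EllipticCurves

open CategoryTheory WeierstrassCurve Field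
open Literature.NumberTheory.GaloisRepresentations
open Literature.NumberTheory.GaloisRepresentations.DiscreteGaloisModule (mu MuCarrier pairing)
open scoped ContRepresentation

-- Cup products need `LocallyCompactSpace Γ_F`; as in the tree's cup-product files, the compactness of
-- absolute Galois groups is a local instance only.
attribute [local instance] absoluteGaloisGroup_compactSpace

variable {F : Type u} [Field F] (W : WeierstrassCurve F) (k d : ℕ)

/-! ## Levels: `E[d] ↪ E[kd]`, `[k] : E[kd] → E[d]`, `k`-th roots

The level maps of `KummerSelmerStructure.lean` (`torsionInclusion`, `torsionMulBy k d`) index the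
torsion by integers and the top level by the product `(k : ℤ) * (d : ℤ)`; the Weil-pairing objects of
`KummerImageIsotropy.lean` (`weilPairingHom W n e`, `weilContPairing`, `mu F n`) index by a natural
number `n`. Here `n = k * d : ℕ`, and `((k * d : ℕ) : ℤ)` is DEFINITIONALLY `(k : ℤ) * (d : ℤ)`, so the
two modules `W.torsionGaloisModule ((k * d : ℕ) : ℤ)` and `W.torsionGaloisModule ((k : ℤ) * (d : ℤ))`
are the same; the maps below are the tree's maps, merely re-typed at the level `((k * d : ℕ) : ℤ)`
(`mulK_apply_eq`, `rfl`). -/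

/-- The inclusion `ι : E[d] ↪ E[kd]` (`torsionInclusion` for `d ∣ kd`). [folklore] -/
abbrev inclKD : (W.torsionGaloisModule (d : ℤ)).toContRepresentation →ⁱL
    (W.torsionGaloisModule ((k * d : ℕ) : ℤ)).toContRepresentation :=
  W.torsionInclusion (Int.natCast_dvd_natCast.mpr (dvd_mul_left d k))

/-- `inclKD` on underlying points is the identity. [folklore] -/
@[simp]
theorem coe_inclKD_apply (S : geomTorsion W (d : ℤ)) :
    ((inclKD W k d S : geomTorsion W ((k * d : ℕ) : ℤ)) : geomPoints W) = S :=
  rfl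

/-- Multiplication by `k`, `[k] : E[kd] → E[d]` (the tree's `torsionMulBy k d`, re-typed at the level
`((k * d : ℕ) : ℤ)`). [folklore] -/
def mulK : (W.torsionGaloisModule ((k * d : ℕ) : ℤ)).toContRepresentation →ⁱL
    (W.torsionGaloisModule (d : ℤ)).toContRepresentation :=
  W.torsionMulBy (k : ℤ) (d : ℤ)

/-- `mulK` is `torsionMulBy k d`. [folklore] -/
theorem mulK_apply_eq (S' : geomTorsion W ((k * d : ℕ) : ℤ)) :
    mulK W k d S' = W.torsionMulBy (k : ℤ) (d : ℤ) S' :=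
  rfl

/-- `mulK` on underlying points: `P ↦ k • P`. [folklore] -/
@[simp]
theorem coe_mulK_apply (S' : geomTorsion W ((k * d : ℕ) : ℤ)) :
    ((mulK W k d S' : geomTorsion W (d : ℤ)) : geomPoints W) = (k : ℤ) • (S' : geomPoints W) :=
  rfl

/-- `ι ([k] S') = k • S'` in `E[kd]`. [folklore] -/
theorem inclKD_mulK (S' : geomTorsion W ((k * d : ℕ) : ℤ)) : inclKD W k d (mulK W k d S') = k • S' := by
  apply Subtype.ext
  rw [coe_inclKD_apply, coe_mulK_apply, AddSubmonoidClass.coe_nsmul, natCast_zsmul]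

variable [CharZero F] [NeZero k]

/-- `[k] : E[kd] → E[d]` is onto (divisibility of `E(F̄)`; tree `torsion_isSES`). [folklore] -/
theorem mulK_surjective : Function.Surjective (mulK W k d) :=
  (W.torsion_isSES (Int.natCast_ne_zero.mpr (NeZero.ne k)) (d : ℤ)).surjective

/-- **A `k`-th root in `E[kd]`** of `T ∈ E[d]`: `k T̃ = T`. [folklore] -/
def kRoot (T : geomTorsion W (d : ℤ)) : geomTorsion W ((k * d : ℕ) : ℤ) :=
  (mulK_surjective W k d T).choose

/-- `[k] (kRoot T) = T`. [folklore] -/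
@[simp]
theorem mulK_kRoot (T : geomTorsion W (d : ℤ)) : mulK W k d (kRoot W k d T) = T :=
  (mulK_surjective W k d T).choose_spec

/-- `ι T = k • kRoot T` in `E[kd]`. [folklore] -/
theorem inclKD_eq_nsmul_kRoot (T : geomTorsion W (d : ℤ)) : inclKD W k d T = k • kRoot W k d T := by
  rw [← inclKD_mulK, mulK_kRoot]

/-- Two `k`-th roots of the same point differ by an element killed by `k`. [folklore] -/
theorem nsmul_kRoot_sub (T : geomTorsion W (d : ℤ)) (T' : geomTorsion W ((k * d : ℕ) : ℤ))
    (hT' : mulK W k d T' = T) : k • (kRoot W k d T - T') = 0 := by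
  rw [nsmul_sub, ← inclKD_mulK, ← inclKD_mulK, mulK_kRoot, hT', sub_self]

/-! ## The descended pairings -/

section Descend

variable [NeZero d]
variable (e : geomTorsion W ((k * d : ℕ) : ℤ) → geomTorsion W ((k * d : ℕ) : ℤ) → AlgebraicClosure F)
  (hμ : ∀ S T, e S T ^ (k * d) = 1)
  (hadd₁ : ∀ S₁ S₂ T, e (S₁ + S₂) T = e S₁ T * e S₂ T)
  (hadd₂ : ∀ S T₁ T₂, e S (T₁ + T₂) = e S T₁ * e S T₂)

/-- The level-`kd` Weil pairing hom `w = weilPairingHom W (kd) e` kills `ι(E[d]) × E[kd][k]`: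
`w(ι S, U) = 0` if `k U = 0` (write `ι S = k S̃`; then `w(kS̃, U) = w(S̃, kU) = 0`). [folklore] -/
theorem weilPairingHom_inclKD_eq_zero_of_nsmul_eq_zero (S : geomTorsion W (d : ℤ))
    (U : geomTorsion W ((k * d : ℕ) : ℤ)) (hU : k • U = 0) :
    weilPairingHom W (k * d) e hμ hadd₁ hadd₂ (inclKD W k d S) U = 0 := by
  rw [inclKD_eq_nsmul_kRoot]
  change (weilPairingHom W (k * d) e hμ hadd₁ hadd₂).flip U (k • kRoot W k d S) = 0
  rw [map_nsmul, AddMonoidHom.flip_apply, ← map_nsmul, hU, map_zero]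

/-- **Well-definedness**: `w(ι S, T̃)` does not depend on the `k`-th root `T̃` of `T`. [folklore] -/
theorem weilPairingHom_inclKD_kRoot_eq (S : geomTorsion W (d : ℤ)) {T : geomTorsion W (d : ℤ)}
    (T' : geomTorsion W ((k * d : ℕ) : ℤ)) (hT' : mulK W k d T' = T) :
    weilPairingHom W (k * d) e hμ hadd₁ hadd₂ (inclKD W k d S) (kRoot W k d T) =
      weilPairingHom W (k * d) e hμ hadd₁ hadd₂ (inclKD W k d S) T' := by
  rw [← sub_eq_zero, ← map_sub]
  exact weilPairingHom_inclKD_eq_zero_of_nsmul_eq_zero W k d e hμ hadd₁ hadd₂ S _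
    (nsmul_kRoot_sub W k d T T' hT')

/-- **The descended pairing hom** `E[d] × E[d] → μ_{kd}`, `(S, T) ↦ e_{kd}(ι S, T̃)` for any `T̃`
with `k T̃ = T` — the compatibility `e_{kd}(ι S, T̃) = e_d(S, k T̃)` of Weil pairings (Silverman
*AEC* III.8.1(e)) used as a DEFINITION of the level-`d` pairing, with values kept in `μ_{kd}`.
[cite: SilvermanAEC2009, Prop. III.8.1(e)] -/
def descendHom : geomTorsion W (d : ℤ) →+ geomTorsion W (d : ℤ) →+ MuCarrier F (k * d) :=
  AddMonoidHom.mk' (fun S => AddMonoidHom.mk'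
      (fun T => weilPairingHom W (k * d) e hμ hadd₁ hadd₂ (inclKD W k d S) (kRoot W k d T))
      fun T₁ T₂ => by
        rw [weilPairingHom_inclKD_kRoot_eq W k d e hμ hadd₁ hadd₂ S (kRoot W k d T₁ + kRoot W k d T₂)
          (by rw [map_add, mulK_kRoot, mulK_kRoot]), map_add])
    fun S₁ S₂ => by
      ext T
      simp only [AddMonoidHom.mk'_apply, AddMonoidHom.add_apply, map_add]

/-- Unfolding `descendHom` with an arbitrary root: `descendHom S T = w(ι S, T̃)` whenever `k T̃ = T`.
[folklore] -/
theorem descendHom_apply_eq (S T : geomTorsion W (d : ℤ)) (T' : geomTorsion W ((k * d : ℕ) : ℤ))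
    (hT' : mulK W k d T' = T) :
    descendHom W k d e hμ hadd₁ hadd₂ S T =
      weilPairingHom W (k * d) e hμ hadd₁ hadd₂ (inclKD W k d S) T' :=
  weilPairingHom_inclKD_kRoot_eq W k d e hμ hadd₁ hadd₂ S T' hT'

/-- `descendHom ([k] S') T = w(S', ι T)`: the symmetric compatibility. [folklore] -/
theorem descendHom_mulK_left (S' : geomTorsion W ((k * d : ℕ) : ℤ)) (T : geomTorsion W (d : ℤ)) :
    descendHom W k d e hμ hadd₁ hadd₂ (mulK W k d S') T =
      weilPairingHom W (k * d) e hμ hadd₁ hadd₂ S' (inclKD W k d T) := by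
  change (weilPairingHom W (k * d) e hμ hadd₁ hadd₂).flip (kRoot W k d T)
    (inclKD W k d (mulK W k d S')) = _
  rw [inclKD_mulK, map_nsmul, AddMonoidHom.flip_apply, ← map_nsmul, ← inclKD_eq_nsmul_kRoot]

/-- **The descended pairing is alternating** if `e` is: `descendHom T T = w(k R, R) = k w(R, R) = 0`
for a root `R` of `T`. [folklore] -/
theorem descendHom_self (halt : ∀ T, e T T = 1) (T : geomTorsion W (d : ℤ)) :
    descendHom W k d e hμ hadd₁ hadd₂ T T = 0 := by
  change (weilPairingHom W (k * d) e hμ hadd₁ hadd₂).flip (kRoot W k d T) (inclKD W k d T) = 0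
  rw [inclKD_eq_nsmul_kRoot, map_nsmul, AddMonoidHom.flip_apply,
    weilPairingHom_self W (k * d) e hμ hadd₁ hadd₂ halt, smul_zero]

/-- **The descended pairing is non-degenerate** (in the second variable) if `e` is: if
`descendHom S T = 0` for all `S` then `T = 0` (`descendHom ([k] S') T = w(S', ι T)` with `S'`
arbitrary, and `ι` is injective). [folklore] -/
theorem eq_zero_of_forall_descendHom_eq_zero (hnd : ∀ T, (∀ S, e S T = 1) → T = 0)
    (T : geomTorsion W (d : ℤ)) (hT : ∀ S, descendHom W k d e hμ hadd₁ hadd₂ S T = 0) : T = 0 := by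
  have h1 : inclKD W k d T = 0 := hnd _ fun S' => by
    have h := hT (mulK W k d S')
    rw [descendHom_mulK_left, muCarrier_eq_iff, coe_weilPairingHom] at h
    exact h
  exact Subtype.ext (congrArg Subtype.val h1 :)

omit [CharZero F] [NeZero k] [NeZero d] in
/-- `[k]` commutes with the Galois action. [folklore] -/
theorem mulK_smul (σ : absoluteGaloisGroup F) (R : geomTorsion W ((k * d : ℕ) : ℤ)) :
    mulK W k d (σ • R) = σ • mulK W k d R :=
  Subtype.ext (smul_zsmul_geomPoints W (k : ℤ) σ (R : geomPoints W)).symm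

/-- **The descended pairing is `Γ_F`-equivariant.** [folklore] -/
theorem descendHom_smul
    (hgal : ∀ (σ : absoluteGaloisGroup F) (S T : geomTorsion W ((k * d : ℕ) : ℤ)),
      σ • e S T = e (σ • S) (σ • T))
    (σ : absoluteGaloisGroup F) (S T : geomTorsion W (d : ℤ)) :
    descendHom W k d e hμ hadd₁ hadd₂ (σ • S) (σ • T) =
      mu F (k * d) σ (descendHom W k d e hμ hadd₁ hadd₂ S T) := by
  rw [descendHom_apply_eq W k d e hμ hadd₁ hadd₂ (σ • S) (σ • T) (σ • kRoot W k d T)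
    (by rw [mulK_smul, mulK_kRoot])]
  exact (weilContPairing W (k * d) e hμ hadd₁ hadd₂ hgal).toLin_smul σ (inclKD W k d S) (kRoot W k d T)

variable (hgal : ∀ (σ : absoluteGaloisGroup F) (S T : geomTorsion W ((k * d : ℕ) : ℤ)),
  σ • e S T = e (σ • S) (σ • T))

/-- **The descended pairing as a `ContPairing`** `E[d] × E[d] → μ_{kd}` of discrete `Γ_F`-modules
(input of the tree's cup product). [folklore] -/
def descendPairing :
    ContPairing (W.torsionGaloisModule (d : ℤ)).toTopRep (W.torsionGaloisModule (d : ℤ)).toTopRep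
      (mu F (k * d)).toTopRep :=
  pairing (W.torsionGaloisModule (d : ℤ)) (W.torsionGaloisModule (d : ℤ)) (mu F (k * d))
    (descendHom W k d e hμ hadd₁ hadd₂) fun σ S T => descendHom_smul W k d e hμ hadd₁ hadd₂ hgal σ S T

/-- Unfolding `descendPairing`. [folklore] -/
@[simp]
theorem descendPairing_toLin_apply (S T : geomTorsion W (d : ℤ)) :
    (descendPairing W k d e hμ hadd₁ hadd₂ hgal).toLin S T = descendHom W k d e hμ hadd₁ hadd₂ S T :=
  rfl

/-- **The mixed pairing** `E[d] × E[kd] → μ_{kd}`, `(S, T̃) ↦ e_{kd}(ι S, T̃)`, as a `ContPairing`.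
[folklore] -/
def mixPairing :
    ContPairing (W.torsionGaloisModule (d : ℤ)).toTopRep
      (W.torsionGaloisModule ((k * d : ℕ) : ℤ)).toTopRep (mu F (k * d)).toTopRep :=
  pairing (W.torsionGaloisModule (d : ℤ)) (W.torsionGaloisModule ((k * d : ℕ) : ℤ)) (mu F (k * d))
    ((weilPairingHom W (k * d) e hμ hadd₁ hadd₂).comp
      (inclKD W k d).toContinuousLinearMap.toLinearMap.toAddMonoidHom)
    fun σ S T => (weilContPairing W (k * d) e hμ hadd₁ hadd₂ hgal).toLin_smul σ (inclKD W k d S) T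

omit [CharZero F] in
/-- Unfolding `mixPairing`. [folklore] -/
@[simp]
theorem mixPairing_toLin_apply (S : geomTorsion W (d : ℤ)) (T : geomTorsion W ((k * d : ℕ) : ℤ)) :
    (mixPairing W k d e hμ hadd₁ hadd₂ hgal).toLin S T =
      weilPairingHom W (k * d) e hμ hadd₁ hadd₂ (inclKD W k d S) T :=
  rfl

/-! ## Cup products -/

omit [CharZero F] in
/-- **`ι_* x ∪_{kd} ỹ = x ∪_mix ỹ`**: the level-`kd` Weil cup product of a class pushed forward from
`H¹(F, E[d])` with any `ỹ ∈ H¹(F, E[kd])` is the mixed cup product (adjoint naturality of the cup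
product along `ι`). [folklore] -/
theorem cupProduct_weil_map_inclKD (x : galoisCohomology (W.torsionGaloisModule (d : ℤ)) 1)
    (y : galoisCohomology (W.torsionGaloisModule ((k * d : ℕ) : ℤ)) 1) :
    (weilContPairing W (k * d) e hμ hadd₁ hadd₂ hgal).cupProduct
        (galoisCohomology.map (inclKD W k d) 1 x) y =
      (mixPairing W k d e hμ hadd₁ hadd₂ hgal).cupProduct x y := by
  have h := ContPairing.cupProduct_adjoint (mixPairing W k d e hμ hadd₁ hadd₂ hgal)
    (weilContPairing W (k * d) e hμ hadd₁ hadd₂ hgal)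
    (DiscreteGaloisModule.homOfIntertwining (inclKD W k d)) (𝟙 _) (fun S T => rfl) x y
  have h1 : (cohomologyMap (𝟙 (W.torsionGaloisModule ((k * d : ℕ) : ℤ)).toTopRep) 1) y = y := by
    rw [show cohomologyMap (𝟙 (W.torsionGaloisModule ((k * d : ℕ) : ℤ)).toTopRep) 1 = 𝟙 _ from
      map_id_eq_id _ (fun _ => rfl) 1]
    rfl
  rw [h1] at h
  exact h

/-- **`x ∪_mix ỹ = x ∪_desc (k_* ỹ)`**: the mixed cup product only depends on `k_* ỹ ∈ H¹(F, E[d])`,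
through the descended pairing (adjoint naturality along `[k]`, and the well-definedness
`e_{kd}(ι S, T̃) = descendHom S (k T̃)`). [folklore] -/
theorem cupProduct_mix_eq_descend (x : galoisCohomology (W.torsionGaloisModule (d : ℤ)) 1)
    (y : galoisCohomology (W.torsionGaloisModule ((k * d : ℕ) : ℤ)) 1) :
    (mixPairing W k d e hμ hadd₁ hadd₂ hgal).cupProduct x y =
      (descendPairing W k d e hμ hadd₁ hadd₂ hgal).cupProduct x
        (galoisCohomology.map (mulK W k d) 1 y) := by
  have h := ContPairing.cupProduct_adjoint (descendPairing W k d e hμ hadd₁ hadd₂ hgal)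
    (mixPairing W k d e hμ hadd₁ hadd₂ hgal) (𝟙 _)
    (DiscreteGaloisModule.homOfIntertwining (mulK W k d))
    (fun S T => (descendHom_apply_eq W k d e hμ hadd₁ hadd₂ S (mulK W k d T) T rfl).symm) x y
  have h1 : (cohomologyMap (𝟙 (W.torsionGaloisModule (d : ℤ)).toTopRep) 1) x = x := by
    rw [show cohomologyMap (𝟙 (W.torsionGaloisModule (d : ℤ)).toTopRep) 1 = 𝟙 _ from
      map_id_eq_id _ (fun _ => rfl) 1]
    rfl
  rw [h1] at h
  exact h

/-- **`ι_* x ∪_{kd} ỹ = x ∪_desc (k_* ỹ)`** (the two previous identities combined): the level-`kd`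
Weil cup product of `ι_* x` with `ỹ` is the descended cup product of `x` with `k_* ỹ`. In the
construction of the Cassels–Tate pairing at level `m` with auxiliary level `m²` (`k = d = m`) this is
the identity `⟨ι c, b'_{v,1}⟩_{m²} = ⟨c, m b'_{v,1}⟩ = ⟨c, b'_v⟩` making the value independent of
the local lift `b'_{v,1}` (Milne, *ADT*, I, proof of Prop. 6.9). [cite: MilneADT2006, Ch. I §6, proof of Prop. 6.9] -/
theorem cupProduct_weil_map_inclKD_eq_descend (x : galoisCohomology (W.torsionGaloisModule (d : ℤ)) 1)
    (y : galoisCohomology (W.torsionGaloisModule ((k * d : ℕ) : ℤ)) 1) :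
    (weilContPairing W (k * d) e hμ hadd₁ hadd₂ hgal).cupProduct
        (galoisCohomology.map (inclKD W k d) 1 x) y =
      (descendPairing W k d e hμ hadd₁ hadd₂ hgal).cupProduct x
        (galoisCohomology.map (mulK W k d) 1 y) := by
  rw [cupProduct_weil_map_inclKD, cupProduct_mix_eq_descend]

/-- In particular **`ι_* x ∪_{kd} ỹ = 0` whenever `k_* ỹ = 0`**. [folklore] -/
theorem cupProduct_weil_map_inclKD_eq_zero (x : galoisCohomology (W.torsionGaloisModule (d : ℤ)) 1)
    {y : galoisCohomology (W.torsionGaloisModule ((k * d : ℕ) : ℤ)) 1}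
    (hy : galoisCohomology.map (mulK W k d) 1 y = 0) :
    (weilContPairing W (k * d) e hμ hadd₁ hadd₂ hgal).cupProduct
      (galoisCohomology.map (inclKD W k d) 1 x) y = 0 := by
  rw [cupProduct_weil_map_inclKD_eq_descend, hy]
  exact map_zero _

end Descend

end Literature.NumberTheory.EllipticCurves
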